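import Summits.BirchSwinnertonDyer.Rank1Residual.X1.RankOneParitySqueeze
import HarnessLib

/-!
# Route P at RANK ONE on the leaf X1 ∩ {r = 1}: `μ_an = 0 ∧ λ_an = 1`, or `λ_an = 3` with the parity
# squeeze, ⇒ Mazur's main conjecture ∧ `BSD(E,p)` (consumers of `X1/RankOneParitySqueeze.lean`)

HONEST FRAMING (cell `b2b-bsdres`, run/shared/lean/b2b/bsd-rank1-residual/, verbatim in every
file): the goal of the cell is to DELETE the COMBINATION-SHAPED residual classes of the
Birch–Swinnerton-Dyer formula for ALL analytic-rank `≤ 1` elliptic curves over `ℚ` — "full BSD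
formula for every rank `≤ 1` curve in class `C`" assembled STRICTLY from published theorems — so
that the rank-`≤ 1` remainder becomes exactly the CONSTRUCTION-SHAPED classes, which are TYPED
(missing-input `Prop`s), NOT attempted. This is not "finishing BSD". Unit `b2b-bsdres-x1b` (prover B,
the independent patchwork — no Keller–Yin input), gen 8; research route; NO CLAIM BEYOND STATED
CLASSES; nothing here changes a label; no new named fact, no new typed def.

WHAT IS HERE. The two rank-one routes of `X1/RankOneParitySqueeze.lean`
(`mazurMainConjecture_of_analyticLambdaEq_one`, `mazurMainConjecture_of_analyticLambdaEq_three`) read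
on x1a's rank-one leaf `RankOne.Leaf W p` (`ClassX1 W p ∧ r_an = 1`, BOTH Greenberg–Vatsal types),
with `BSD(E,p)` attached through x1a's `RankOne.Leaf.bsdp_of_mazurMainConjecture_of_schneider`
(Perrin-Riou–Schneider, Perrin-Riou 1987, Mazur–Tate sigma, modularity, GZK — all PUBLISHED):

* `RankOne.Leaf.schneider_of_analyticLambdaEq_one` — `λ_an = 1` alone gives `[T¹]L_p(f,α) ≠ 0`, i.e.
  Schneider's non-degeneracy of THE canonical `p`-adic height (x1a's certificate converter);
* `RankOne.Leaf.mazurMainConjecture_and_bsdp_of_muZero_lamOne` — **`μ_an = 0 ∧ λ_an = 1 ⇒ Mazur's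
  MC ∧ BSD(E,p)`**: no `p`-adic height, no descent, no value of `#Ш(E/ℚ)_an` (census: 250 + 10 of the
  699 + 68 rank-one X1 pairs at `p = 3, 5` with `N < 2·10⁴`, iw-2 IWASAWA-CENSUS §4.4, two engines);
  general μ-part form `…_of_muPartAt_of_lamOne`;
* `RankOne.Leaf.mazurMainConjecture_and_bsdp_of_lamThree` — `μ_an ≤ m`, μ-part, `λ_an = 3`, the
  Schneider certificate in valued form `Reg_p ≠ 0 ∧ v ≤ ord_p Reg_p` (the cell's ENGINE-3 column:
  `v = v_p(h_p(P)) + 1 = v_p(Reg_PARI)`, tree normalisation `⟨P,P⟩ = -2p·h_p(P)`) and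
  `hb : m + 2·ord_p #E(ℚ)_tors + 1 < v + ord_p ∏c_ℓ + 2·ord_p #Ẽ(𝔽_p)` ⇒ Mazur's MC ∧ BSD(E,p)
  (314 of the 772 census pairs have `λ_an = 3`); headline forms with `hb` discharged: no rational
  `p`-torsion and `v ≥ 0` (`…_of_not_dvd_torsionOrder`), or `p ∥ #E(ℚ)_tors` and `v + ord_p ∏c_ℓ ≥ 2`
  (`…_of_padicValNat_torsionOrder_eq_one`);
* `RankOne.Leaf.mazurMainConjecture_and_bsdp_of_norm_coeff_one_eq_one` — route P₁ as a ONE-NUMBER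
  certificate: **`‖[T¹](ϖ·L_p(f,α))‖_p = 1 ⇒ Mazur's MC ∧ BSD(E,p)`** (⟺ `(μ_an, λ_an) = (0,1)` on the leaf);
* `RankOne.Leaf.odd_of_analyticLambdaEq` — a certified `λ_an` on the rank-one leaf is ODD
  (`X1/LambdaParity.lean`), so the first case beyond these routes is `λ_an = 5` (198 census pairs,
  among them `15834t1@5` with `λ_an = 9`).

References: [GreenbergLNM1716] Prop. 3.10, §5 p. 183; [Wuthrich2014] Thm. 16;
[BalakrishnanMullerStein2015] Thm. 1.7; [PerrinRiou1987] §1.4 Cor. 1.8; [MazurTateTeitelbaum1986Invent]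
§I.17–I.18; HOME/b2b-bsdres-x1b/X1-B.md §13.
-/

noncomputable section

open scoped Classical MatrixGroups ModularForm

open PowerSeries CongruenceSubgroup WeierstrassCurve Literature.NumberTheory.EllipticCurves
  Literature.NumberTheory.EllipticCurves.ModularForms
  Literature.NumberTheory.EllipticCurves.Rank1Residual
  Literature.NumberTheory.EllipticCurves.Greenberg1999
  Summit.BirchSwinnertonDyer.BirchSwinnertonDyer.Theorems.Rank1ResidualX1Defs
  Summit.BirchSwinnertonDyer.Rank1Residual.X1.MuLambda
  Summit.BirchSwinnertonDyer.Rank1Residual.X1.MuPart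
  Summit.BirchSwinnertonDyer.Rank1Residual.X1.ParitySqueeze

set_option autoImplicit false

namespace Summit.BirchSwinnertonDyer.Rank1Residual.X1.RankOneParitySqueeze

/-! ## §3. On the rank-one leaf X1 ∩ {r = 1} (x1a's `RankOne.Leaf`, both GV types): MC and `BSD(E,p)` -/

section Leaf

variable {W : WeierstrassCurve ℚ} [W.IsElliptic] [W.IsGloballyMinimal] {p : ℕ} [Fact p.Prime]

/-- **`λ_an = 1` on the rank-one leaf ⇒ Schneider's non-degeneracy of THE canonical `p`-adic height.**
With modularity (`hmod`: newform and `ϖ`) and Wuthrich Thm. 16 (`hW16`: `ϖ·L_p = ι(g)`, `g ∈ Λ`),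
`λ(g) = 1` makes `[T¹] g = p^{μ(g)}·unit ≠ 0`, hence `[T¹] L_p(f,α) ≠ 0` — x1a's certificate
(`RankOne.Leaf.schneider_of_coeff_one_ne_zero`: Perrin-Riou 1987 `hPR`, GZK `hGZK`).
[cite: PerrinRiou1987, §1.4 Cor. 1.8] [cite: Wuthrich2014, Thm. 16 (p. 393)] -/
theorem _root_.Summit.BirchSwinnertonDyer.Rank1Residual.X1.RankOne.Leaf.schneider_of_analyticLambdaEq_one
    (hW16 : Wuthrich2014.charIdeal_dvd_padicLFunction) (hPR : perrinRiou_rankOne_leadingTerms_odd)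
    (hmod : nonempty_modularParametrizationData) (hGZK : rank_eq_analyticRank_of_analyticRank_le_one)
    (hL : RankOne.Leaf W p) (hlam1 : AnalyticLambdaEq W p 1) :
    ∀ Dh : PAdicHeightData W p, Dh.IsCanonical → SchneiderConjecture Dh := by
  have hX := isClassX1_of_classX1 hL.1
  haveI : NeZero (W.conductorNorm ℤ) := ⟨(W.conductorNorm_pos_holds).ne'⟩
  obtain ⟨Dm⟩ := hmod W
  have hf : IsNewformOf W Dm.f := Dm.isNewformOf
  obtain ⟨ϖ, hϖpos, hϖeq, -⟩ := Dm.exists_rat_mul_realPeriodRat_eq_plusPeriod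
  obtain ⟨κ, hκ, γ, hγ, hγ'⟩ := exists_isCyclotomic_isTopGenerator_isCyclotomicVariable_holds p
  obtain ⟨D⟩ := W.nonempty_selmerDualData_holds κ γ hγ
  obtain ⟨-, g, -, hιg⟩ := hW16 W p hX.two_ne ⟨hX.hasGoodReductionAtPrime, hX.not_dvd_frobeniusTrace⟩
    hX.not_hasIrreducibleModPGaloisRep hκ hγ hγ' hf D ϖ hϖeq
  have hlam : lam g = 1 := hlam1 Dm.f hf ϖ hϖeq g hιg
  have hg0 : g ≠ 0 := by
    have := mul_ne_zero_of_iota_eq (g := g) (h := 1) hX.hasGoodReductionAtPrime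
      hX.not_dvd_frobeniusTrace hf hϖeq D (by rw [mul_one]; exact hιg)
    rwa [mul_one] at this
  have hc : coeff 1 g ≠ 0 := by rw [← hlam]; exact coeff_lam_ne_zero hg0
  have hcoeff : coeff 1 (padicLFunction Dm.f (unitRoot W p : ℚ_[p])) ≠ 0 := by
    intro h0
    apply hc
    have e := Wuthrich2014.coeff_iwasawaToPowerSeries p g 1
    rw [hιg, coeff_C_mul, h0, mul_zero] at e
    exact_mod_cast (PadicInt.coe_eq_zero.mp e.symm)
  exact hL.schneider_of_coeff_one_ne_zero hPR hGZK Dm.f hf hcoeff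

/-- **Route P₁ on the rank-one leaf (general μ-part): `MuPartAt ∧ λ_an = 1 ⇒ Mazur's MC ∧ BSD(E,p)`**,
granted the PUBLISHED facts Wuthrich Thm. 16, Perrin-Riou–Schneider, Perrin-Riou 1987, Mazur–Tate sigma,
modularity, GZK. `BSD(E,p)` through x1a's `RankOne.Leaf.bsdp_of_mazurMainConjecture_of_schneider`, the
Schneider certificate being a CONSEQUENCE of `λ_an = 1` (`schneider_of_analyticLambdaEq_one`).
[cite: Wuthrich2014, Thm. 16 (p. 393)] [cite: BalakrishnanMullerStein2015, Thm. 1.7]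
[cite: PerrinRiou1987, §1.4 Cor. 1.8] -/
theorem _root_.Summit.BirchSwinnertonDyer.Rank1Residual.X1.RankOne.Leaf.mazurMainConjecture_and_bsdp_of_muPartAt_of_lamOne
    (hW16 : Wuthrich2014.charIdeal_dvd_padicLFunction) (hS : Schneider1985_order_charGenerator_odd)
    (hPR : perrinRiou_rankOne_leadingTerms_odd) (hMT : mazur_tate_sigma_exists_odd)
    (hmod : nonempty_modularParametrizationData) (hGZK : rank_eq_analyticRank_of_analyticRank_le_one)
    (hL : RankOne.Leaf W p) (hμ : MuPartAt W p) (hlam1 : AnalyticLambdaEq W p 1) :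
    MazurMainConjecture W p ∧ BSDp W p := by
  have hX := isClassX1_of_classX1 hL.1
  have hMC : MazurMainConjecture W p :=
    mazurMainConjecture_of_analyticLambdaEq_one hW16 hS hMT hGZK hX.two_ne hX.hasGoodReductionAtPrime
      hX.not_dvd_frobeniusTrace hX.not_hasIrreducibleModPGaloisRep hL.analyticRank_eq_one hμ hlam1
  exact ⟨hMC, hL.bsdp_of_mazurMainConjecture_of_schneider hS hPR hMT hmod hGZK
    (hL.schneider_of_analyticLambdaEq_one hW16 hPR hmod hGZK hlam1) hMC⟩

/-- **Route P₁, headline form: on the rank-one leaf, `μ_an = 0 ∧ λ_an = 1 ⇒ Mazur's MC ∧ BSD(E,p)`**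
(μ-part automatic at `μ_an = 0`, `MuPart.muPartAt_of_analyticMuLE_zero`). No `p`-adic height, no
descent, no value of `#Ш(E/ℚ)_an` enters: the certificate is two Iwasawa invariants of `ϖ·L_p(E,T)`
(two engines in the cell's census: 250 + 10 of the rank-one X1 pairs at `p = 3, 5` with `N < 2·10⁴`).
[cite: Wuthrich2014, Thm. 16 (p. 393)] [cite: BalakrishnanMullerStein2015, Thm. 1.7]
[cite: PerrinRiou1987, §1.4 Cor. 1.8] [cite: GreenbergVatsal2000, (1)–(2)] -/
theorem _root_.Summit.BirchSwinnertonDyer.Rank1Residual.X1.RankOne.Leaf.mazurMainConjecture_and_bsdp_of_muZero_lamOne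
    (hW16 : Wuthrich2014.charIdeal_dvd_padicLFunction) (hS : Schneider1985_order_charGenerator_odd)
    (hPR : perrinRiou_rankOne_leadingTerms_odd) (hMT : mazur_tate_sigma_exists_odd)
    (hmod : nonempty_modularParametrizationData) (hGZK : rank_eq_analyticRank_of_analyticRank_le_one)
    (hL : RankOne.Leaf W p) (hμ0 : AnalyticMuLE W p 0) (hlam1 : AnalyticLambdaEq W p 1) :
    MazurMainConjecture W p ∧ BSDp W p :=
  have hX := isClassX1_of_classX1 hL.1
  hL.mazurMainConjecture_and_bsdp_of_muPartAt_of_lamOne hW16 hS hPR hMT hmod hGZK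
    (muPartAt_of_analyticMuLE_zero hW16 hX.two_ne hX.hasGoodReductionAtPrime hX.not_dvd_frobeniusTrace
      hX.not_hasIrreducibleModPGaloisRep hμ0) hlam1

/-- **Route P₃ on the rank-one leaf (general form): `μ_an ≤ m`, μ-part, `λ_an = 3`, the valued Schneider
certificate `Reg_p ≠ 0 ∧ v ≤ ord_p Reg_p` and `hb` ⇒ Mazur's MC ∧ BSD(E,p)`**, granted the PUBLISHED facts
Wuthrich Thm. 16, Perrin-Riou–Schneider, Perrin-Riou 1987, Mazur–Tate sigma, modularity, GZK and
Greenberg Prop. 3.10. (Census currency: `v = v_p(h_p(P)) + 1` for the cell's ENGINE-3 value `h_p(P)` of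
the Mordell–Weil generator in the Mazur–Stein–Tate normalisation, `⟨P,P⟩ = -2p·h_p(P)`.)
[cite: GreenbergLNM1716, Prop. 3.10 and §5 p. 183] [cite: Wuthrich2014, Thm. 16 (p. 393)]
[cite: BalakrishnanMullerStein2015, Thm. 1.7] [cite: PerrinRiou1987, §1.4 Cor. 1.8] -/
theorem _root_.Summit.BirchSwinnertonDyer.Rank1Residual.X1.RankOne.Leaf.mazurMainConjecture_and_bsdp_of_lamThree
    (hW16 : Wuthrich2014.charIdeal_dvd_padicLFunction) (hS : Schneider1985_order_charGenerator_odd)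
    (hPR : perrinRiou_rankOne_leadingTerms_odd) (hMT : mazur_tate_sigma_exists_odd)
    (hmod : nonempty_modularParametrizationData) (hGZK : rank_eq_analyticRank_of_analyticRank_le_one)
    (h310 : prop310_selmerCorank_mod_two_eq_lambdaInvariant) (hL : RankOne.Leaf W p)
    {m : ℕ} (hμan : AnalyticMuLE W p m) (hμ : MuPartAt W p) (hlam3 : AnalyticLambdaEq W p 3)
    {v : ℤ} (hReg : ∀ Dh : PAdicHeightData W p, Dh.IsCanonical →
      padicRegulator Dh ≠ 0 ∧ v ≤ (padicRegulator Dh).valuation)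
    (hb : (m : ℤ) + 2 * padicValNat p W.torsionOrder + 1 <
      v + padicValNat p W.tamagawaProduct + 2 * padicValNat p (W.reductionPointCount p)) :
    MazurMainConjecture W p ∧ BSDp W p := by
  have hX := isClassX1_of_classX1 hL.1
  have hMC : MazurMainConjecture W p :=
    mazurMainConjecture_of_analyticLambdaEq_three hW16 hS hMT hGZK h310 hX.two_ne
      hX.hasGoodReductionAtPrime hX.not_dvd_frobeniusTrace hX.not_hasIrreducibleModPGaloisRep
      hL.analyticRank_eq_one hμan hμ hlam3 (fun Dh hDh ↦ (hReg Dh hDh).2) hb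
  exact ⟨hMC, hL.bsdp_of_mazurMainConjecture_of_schneider hS hPR hMT hmod hGZK
    (fun Dh hDh ↦ (hReg Dh hDh).1) hMC⟩

omit [W.IsElliptic] in
/-- On the rank-one leaf `p ∣ #Ẽ(𝔽_p)` (anomalous), so `ord_p #Ẽ(𝔽_p) ≥ 1`. [folklore] -/
theorem _root_.Summit.BirchSwinnertonDyer.Rank1Residual.X1.RankOne.Leaf.one_le_padicValNat_reductionPointCount
    (hL : RankOne.Leaf W p) : 1 ≤ padicValNat p (W.reductionPointCount p) := by
  have hX := isClassX1_of_classX1 hL.1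
  haveI : NeZero p := ⟨(Fact.out : p.Prime).ne_zero⟩
  have hdvd : p ∣ W.reductionPointCount p :=
    (dvd_reductionPointCount_iff_dvd_frobeniusTrace_sub_one W p).mpr hX.dvd_frobeniusTrace_sub_one
  exact one_le_padicValNat_of_dvd (W.reductionPointCount_pos p).ne' hdvd

/-- **Route P₃, headline form at a member WITHOUT rational `p`-torsion** (every type-B pair, and the
`φ ≠ 1` type-A pairs): `μ_an = 0`, `λ_an = 3` and a valued Schneider certificate with `v ≥ 0`
(`ord_p Reg_p ≥ 0`, i.e. `v_p(h_p(P)) ≥ -1`) ⇒ Mazur's MC ∧ BSD(E,p) — `hb` is automatic: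
`0 + 0 + 1 < v + ord_p ∏c_ℓ + 2·ord_p #Ẽ(𝔽_p)` as `p ∣ #Ẽ(𝔽_p)`.
[cite: GreenbergLNM1716, Prop. 3.10 and §5 p. 183] [cite: Wuthrich2014, Thm. 16 (p. 393)]
[cite: BalakrishnanMullerStein2015, Thm. 1.7] [cite: PerrinRiou1987, §1.4 Cor. 1.8] -/
theorem _root_.Summit.BirchSwinnertonDyer.Rank1Residual.X1.RankOne.Leaf.mazurMainConjecture_and_bsdp_of_muZero_lamThree_of_not_dvd_torsionOrder
    (hW16 : Wuthrich2014.charIdeal_dvd_padicLFunction) (hS : Schneider1985_order_charGenerator_odd)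
    (hPR : perrinRiou_rankOne_leadingTerms_odd) (hMT : mazur_tate_sigma_exists_odd)
    (hmod : nonempty_modularParametrizationData) (hGZK : rank_eq_analyticRank_of_analyticRank_le_one)
    (h310 : prop310_selmerCorank_mod_two_eq_lambdaInvariant) (hL : RankOne.Leaf W p)
    (htors : ¬ p ∣ W.torsionOrder) (hμ0 : AnalyticMuLE W p 0) (hlam3 : AnalyticLambdaEq W p 3)
    {v : ℤ} (hv0 : 0 ≤ v) (hReg : ∀ Dh : PAdicHeightData W p, Dh.IsCanonical →
      padicRegulator Dh ≠ 0 ∧ v ≤ (padicRegulator Dh).valuation) :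
    MazurMainConjecture W p ∧ BSDp W p := by
  have hX := isClassX1_of_classX1 hL.1
  refine hL.mazurMainConjecture_and_bsdp_of_lamThree hW16 hS hPR hMT hmod hGZK h310 hμ0
    (muPartAt_of_analyticMuLE_zero hW16 hX.two_ne hX.hasGoodReductionAtPrime hX.not_dvd_frobeniusTrace
      hX.not_hasIrreducibleModPGaloisRep hμ0) hlam3 hReg ?_
  have h0 : (padicValNat p W.torsionOrder : ℤ) = 0 := by
    exact_mod_cast padicValNat.eq_zero_of_not_dvd htors
  have h1 : (1 : ℤ) ≤ padicValNat p (W.reductionPointCount p) := by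
    exact_mod_cast hL.one_le_padicValNat_reductionPointCount
  have hc : (0 : ℤ) ≤ padicValNat p W.tamagawaProduct := by exact_mod_cast Nat.zero_le _
  simp only [Nat.cast_zero, zero_add, h0, mul_zero]
  linarith

/-- **Route P₃, headline form at a member with `p ∥ #E(ℚ)_tors`** (the bulk of the `φ = 1` type-A
pairs): `μ_an = 0`, `λ_an = 3`, and a valued Schneider certificate with
`2 ≤ v + ord_p ∏c_ℓ` (e.g. `v_p(h_p(P)) ≥ 1`, or `v_p(h_p(P)) ≥ 0 ∧ p ∣ ∏c_ℓ`, or `p² ∣ ∏c_ℓ` with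
`v_p(h_p(P)) ≥ -1`) ⇒ Mazur's MC ∧ BSD(E,p).
[cite: GreenbergLNM1716, Prop. 3.10 and §5 p. 183] [cite: Wuthrich2014, Thm. 16 (p. 393)]
[cite: BalakrishnanMullerStein2015, Thm. 1.7] [cite: PerrinRiou1987, §1.4 Cor. 1.8] -/
theorem _root_.Summit.BirchSwinnertonDyer.Rank1Residual.X1.RankOne.Leaf.mazurMainConjecture_and_bsdp_of_muZero_lamThree_of_padicValNat_torsionOrder_eq_one
    (hW16 : Wuthrich2014.charIdeal_dvd_padicLFunction) (hS : Schneider1985_order_charGenerator_odd)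
    (hPR : perrinRiou_rankOne_leadingTerms_odd) (hMT : mazur_tate_sigma_exists_odd)
    (hmod : nonempty_modularParametrizationData) (hGZK : rank_eq_analyticRank_of_analyticRank_le_one)
    (h310 : prop310_selmerCorank_mod_two_eq_lambdaInvariant) (hL : RankOne.Leaf W p)
    (htors : padicValNat p W.torsionOrder = 1) (hμ0 : AnalyticMuLE W p 0) (hlam3 : AnalyticLambdaEq W p 3)
    {v : ℤ} (hvc : 2 ≤ v + padicValNat p W.tamagawaProduct)
    (hReg : ∀ Dh : PAdicHeightData W p, Dh.IsCanonical →
      padicRegulator Dh ≠ 0 ∧ v ≤ (padicRegulator Dh).valuation) :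
    MazurMainConjecture W p ∧ BSDp W p := by
  have hX := isClassX1_of_classX1 hL.1
  refine hL.mazurMainConjecture_and_bsdp_of_lamThree hW16 hS hPR hMT hmod hGZK h310 hμ0
    (muPartAt_of_analyticMuLE_zero hW16 hX.two_ne hX.hasGoodReductionAtPrime hX.not_dvd_frobeniusTrace
      hX.not_hasIrreducibleModPGaloisRep hμ0) hlam3 hReg ?_
  have h0 : (padicValNat p W.torsionOrder : ℤ) = 1 := by exact_mod_cast htors
  have h1 : (1 : ℤ) ≤ padicValNat p (W.reductionPointCount p) := by
    exact_mod_cast hL.one_le_padicValNat_reductionPointCount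
  simp only [Nat.cast_zero, zero_add, h0, mul_one]
  linarith

end Leaf

/-! ## §4. Consistency with `X1/LambdaParity.lean`: a certified `λ_an` on the rank-one leaf is odd -/

section Consistency

variable {W : WeierstrassCurve ℚ} [W.IsElliptic] [W.IsGloballyMinimal] {p : ℕ} [Fact p.Prime]

/-- **On the rank-one leaf a certified analytic λ-invariant is ODD** (so after `λ_an = 1` and
`λ_an = 3` the next case is `λ_an = 5`): the data exist (modularity `hmod`; Wuthrich Thm. 16 `hW16`:
`g ∈ Λ` with `ι(g) = ϖ·L_p(f,α)`) and `λ(g) ≡ r_an = 1 (mod 2)`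
(`LambdaParity.odd_lam_of_analyticRank_eq_one`, PROVED from the Mazur–Tate–Teitelbaum functional
equation). [cite: MazurTateTeitelbaum1986Invent, §I.17–I.18] [cite: Wuthrich2014, Thm. 16 (p. 393)] -/
theorem _root_.Summit.BirchSwinnertonDyer.Rank1Residual.X1.RankOne.Leaf.odd_of_analyticLambdaEq
    (hW16 : Wuthrich2014.charIdeal_dvd_padicLFunction) (hmod : nonempty_modularParametrizationData)
    (hL : RankOne.Leaf W p) {n : ℕ} (hn : AnalyticLambdaEq W p n) : Odd n := by
  have hX := isClassX1_of_classX1 hL.1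
  haveI : NeZero (W.conductorNorm ℤ) := ⟨(W.conductorNorm_pos_holds).ne'⟩
  obtain ⟨Dm⟩ := hmod W
  have hf : IsNewformOf W Dm.f := Dm.isNewformOf
  obtain ⟨ϖ, hϖpos, hϖeq, -⟩ := Dm.exists_rat_mul_realPeriodRat_eq_plusPeriod
  obtain ⟨κ, hκ, γ, hγ, hγ'⟩ := exists_isCyclotomic_isTopGenerator_isCyclotomicVariable_holds p
  obtain ⟨D⟩ := W.nonempty_selmerDualData_holds κ γ hγ
  obtain ⟨-, g, -, hιg⟩ := hW16 W p hX.two_ne ⟨hX.hasGoodReductionAtPrime, hX.not_dvd_frobeniusTrace⟩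
    hX.not_hasIrreducibleModPGaloisRep hκ hγ hγ' hf D ϖ hϖeq
  rw [← hn Dm.f hf ϖ hϖeq g hιg]
  exact LambdaParity.odd_lam_of_analyticRank_eq_one W p hX.two_ne hf
    ⟨hX.hasGoodReductionAtPrime, hX.not_dvd_frobeniusTrace⟩ (by exact_mod_cast hϖpos.ne') hιg
    hL.analyticRank_eq_one

end Consistency

/-! ## §5. Route P₁ as a ONE-NUMBER certificate: `‖[T¹](ϖ·L_p(f,α))‖_p = 1` -/

section OneNumber

variable {W : WeierstrassCurve ℚ} [W.IsElliptic] [W.IsGloballyMinimal] {p : ℕ} [Fact p.Prime]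

omit [W.IsElliptic] [W.IsGloballyMinimal] in
/-- Λ-algebra: if `g(0) = 0` and `[T¹] g` is a unit of `ℤ_p` then `μ(g) = 0` and `λ(g) = 1`
(`g ≡ u·T (mod (p, T²))` with `u ∈ ℤ_pˣ`, which is all that `μ` and `λ` see). [cite: Washington1997, §7.1] -/
theorem mu_eq_zero_and_lam_eq_one_of_isUnit_coeff_one {g : IwasawaAlgebra p}
    (h0 : constantCoeff g = 0) (h1 : IsUnit (coeff 1 g)) : mu g = 0 ∧ lam g = 1 := by
  have hres : IsLocalRing.residue ℤ_[p] (coeff 1 g) ≠ 0 := by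
    rw [Ne, IsLocalRing.residue_eq_zero_iff]
    exact fun hm ↦ (IsLocalRing.mem_maximalIdeal _).mp hm h1
  have hc1 : coeff 1 (red g) ≠ 0 := by rwa [coeff_map]
  have hred : red g ≠ 0 := fun h ↦ hc1 (by rw [h, map_zero])
  obtain ⟨hmu, hpf⟩ := mu_eq_and_pfree_eq (a := 0) hred (by rw [pow_zero, map_one, one_mul])
  refine ⟨hmu, ?_⟩
  have hord : (red g).order = 1 := by
    rw [show (1 : ℕ∞) = ((1 : ℕ) : ℕ∞) from rfl, order_eq_nat]
    refine ⟨hc1, fun i hi ↦ ?_⟩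
    obtain rfl : i = 0 := by omega
    rw [coeff_map, coeff_zero_eq_constantCoeff_apply, h0, map_zero]
  rw [lam, hpf, hord]
  rfl

/-- **Route P₁ as a ONE-NUMBER certificate on the rank-one leaf:
`‖[T¹](ϖ·L_p(f,α))‖_p = 1 ⇒ Mazur's main conjecture ∧ BSD(E,p)`** (for the newform `f` of `E` at
level `N_E` and the Néron normalisation `ϖ·Ω_E = Ω⁺_f`). The linear coefficient of the
Néron-normalised `p`-adic `L`-series being a `p`-adic UNIT is the same as `(μ_an, λ_an) = (0, 1)`
(`L_p(0) = 0` on the leaf; `mu_eq_zero_and_lam_eq_one_of_isUnit_coeff_one` on Wuthrich's integral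
`g` with `ι(g) = ϖ·L_p`), so `RankOne.Leaf.mazurMainConjecture_and_bsdp_of_muZero_lamOne` applies:
PUBLISHED facts Wuthrich Thm. 16, Perrin-Riou–Schneider, Perrin-Riou 1987, Mazur–Tate sigma,
modularity, GZK; no height, no descent, no `#Ш_an`. (x1a computes `[T¹]L_p` per pair: X1-CHAIN
§12; iw-2 the pair `(μ, λ)`.) [cite: Wuthrich2014, Thm. 16 (p. 393)]
[cite: BalakrishnanMullerStein2015, Thm. 1.7] [cite: PerrinRiou1987, §1.4 Cor. 1.8] -/
theorem _root_.Summit.BirchSwinnertonDyer.Rank1Residual.X1.RankOne.Leaf.mazurMainConjecture_and_bsdp_of_norm_coeff_one_eq_one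
    (hW16 : Wuthrich2014.charIdeal_dvd_padicLFunction) (hS : Schneider1985_order_charGenerator_odd)
    (hPR : perrinRiou_rankOne_leadingTerms_odd) (hMT : mazur_tate_sigma_exists_odd)
    (hmod : nonempty_modularParametrizationData) (hGZK : rank_eq_analyticRank_of_analyticRank_le_one)
    (hL : RankOne.Leaf W p)
    (hcoeff : ∀ [NeZero (W.conductorNorm ℤ)] (f : CuspForm (Gamma0 (W.conductorNorm ℤ)) 2),
      IsNewformOf W f → ∀ (ϖ : ℚ), (ϖ : ℝ) * W.realPeriodRat = plusPeriod f →
      ‖coeff 1 (C (ϖ : ℚ_[p]) * padicLFunction f (unitRoot W p : ℚ_[p]))‖ = 1) :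
    MazurMainConjecture W p ∧ BSDp W p := by
  have hpP : p.Prime := Fact.out
  have hμ0 : AnalyticMuLE W p 0 := by
    intro _ f hf ϖ hϖ
    refine ⟨1, ?_⟩
    rw [hcoeff f hf ϖ hϖ, Nat.cast_zero, zero_add, zpow_neg, zpow_one]
    exact inv_lt_one_of_one_lt₀ (by exact_mod_cast hpP.one_lt)
  have hlam1 : AnalyticLambdaEq W p 1 := by
    intro _ f hf ϖ hϖ g hιg
    have h0 : constantCoeff g = 0 := by
      have e := constantCoeff_iwasawaToPowerSeries p g
      rw [hιg, map_mul, constantCoeff_C, Wuthrich2014.constantCoeff_padicLFunction_eq_zero_of_analyticRank_eq_one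
        W p hL.isOrdinaryAt hL.analyticRank_eq_one f hf, mul_zero] at e
      exact_mod_cast (PadicInt.coe_eq_zero.mp e.symm)
    have h1 : IsUnit (coeff 1 g) := by
      rw [PadicInt.isUnit_iff, PadicInt.norm_def, ← Wuthrich2014.coeff_iwasawaToPowerSeries p g 1, hιg]
      exact hcoeff f hf ϖ hϖ
    exact (mu_eq_zero_and_lam_eq_one_of_isUnit_coeff_one h0 h1).2
  exact hL.mazurMainConjecture_and_bsdp_of_muZero_lamOne hW16 hS hPR hMT hmod hGZK hμ0 hlam1

end OneNumber

end Summit.BirchSwinnertonDyer.Rank1Residual.X1.RankOneParitySqueeze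

end
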